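import Mathlib
import Summits.Ventures.PercRepro2.HCov
import Summits.Ventures.PercRepro2.HCovSwap
import Summits.Ventures.PercRepro2.ContractDefs
import Summits.Ventures.PercRepro2.RECMReduction
import Summits.Ventures.PercRepro2.GcTransport
import Summits.Ventures.PercRepro2.GcTransportMarks
import Summits.Ventures.PercRepro2.GcSeries
import Summits.Ventures.PercRepro2.GcParallel
import Summits.Ventures.PercRepro2.CCWReduced
import Summits.Ventures.PercRepro2.LeafLinearity
import Summits.Ventures.PercRepro2.RootCoincidence
import Summits.Ventures.PercRepro2.SepZeroSep
import Summits.Ventures.PercRepro2.PendantOB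
import Summits.Ventures.PercRepro2.PendantBO
import Summits.Ventures.PercRepro2.DiagBA3
import Summits.Ventures.PercRepro2.GcSkelRules

/-!
# The weighted reduced-class theorem for (HCOV) (blind cell PercRepro2, typer-1 g52)

**The weighted reduced class** `WReduced ends o a₁ a₂ a₃ b`: the graph is SIMPLE (no two parallel
non-loop edges, `RECM.Simple`), every unmarked vertex has non-loop degree `0` or `≥ 3`, and neither
`o` nor `b` has non-loop degree `1`. It is the weighted counterpart of the typed `Reduced` class of
S1 (loops, parallel pairs, unmarked leaves, unmarked series vertices, `o`- and `b`-leaves removed)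
without the root-pair clause, which the weighted calculus does not remove (`gap` is not
`Q`-restricted).

**THE THEOREM** (`HCov_all_of_HCovWRed_all`, and the equivalence `HCov_all_iff_HCovWRed_all`):
(HCOV) for every finite weighted graph with five distinct marks follows from (HCOV) on the weighted
reduced class — by strong induction on `nonLoopCard`: a parallel pair is merged (`Gc_parallel`), an
unmarked leaf is deleted (`Gc_leaf_at`), an unmarked series vertex is contracted (`Gc_series_at`),
an `o`-leaf (resp. `b`-leaf) at `x` moves the mark to `x` (`LeafLinearity.Gc_leaf_o` / `Gc_leaf_b`,
after its loops are relocated) — at a root the instance vanishes (`RootCoincidence`, the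
(SEP-2) / (SEP-3) zeros), at `a₃` it is the (A3-O) zero (`SepZero`) resp. the diagonal
`DiagBA3`, at the other of `o, b` the diagonal `PendantOB` / `PendantBO`, and at an unmarked `x`
the old mark becomes an unmarked leaf and the induction hypothesis applies.

This is step (1) of the forest reduction of S3.1 for `Gc` (leaf and series moves), for every graph.
-/

namespace Summit.Ventures.PercRepro2

open CovForm Contract RECM

namespace WRed

/-! ## The weighted reduced class -/

section Class

variable {V : Type*} {E : Type*} [Fintype E] [DecidableEq E] [DecidableEq V]

/-- **The weighted reduced class**: simple, every unmarked vertex of non-loop degree `0` or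
`≥ 3`, and `o`, `b` not of non-loop degree `1`. -/
structure WReduced (ends : E → Sym2 V) (o a₁ a₂ a₃ b : V) : Prop where
  /-- no two parallel non-loop edges -/
  simple : Simple ends
  /-- no unmarked leaf, no unmarked series vertex -/
  unmarked : ∀ y, Unmarked o a₁ a₂ a₃ b y → nonLoopDeg ends y ≠ 1 ∧ nonLoopDeg ends y ≠ 2
  /-- `o` is not a leaf -/
  deg_o : nonLoopDeg ends o ≠ 1
  /-- `b` is not a leaf -/
  deg_b : nonLoopDeg ends b ≠ 1

end Class

section Closure

variable (R : Type*) [Field R] [LinearOrder R] [IsStrictOrderedRing R]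

/-- **(HCOV) on the weighted reduced class**: for every finite graph in `WReduced` with distinct
marks and admissible weights. -/
def HCovWRed_all : Prop :=
  ∀ (V E : Type) [Fintype V] [DecidableEq V] [Fintype E] [DecidableEq E]
    (ends : E → Sym2 V) (p : E → R), IsProbVec p →
    ∀ o a₁ a₂ a₃ b : V, a₁ ≠ a₂ → a₁ ≠ a₃ → a₂ ≠ a₃ → o ≠ a₁ → o ≠ a₂ → o ≠ a₃ → o ≠ b →
      b ≠ a₁ → b ≠ a₂ → b ≠ a₃ → WReduced ends o a₁ a₂ a₃ b → HCov p ends o a₁ a₂ a₃ b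

/-- The induction hypothesis: (HCOV) on every admissible instance on `V, E` with fewer than `n`
non-loop edges. -/
def IHBelow (V E : Type) [Fintype E] [DecidableEq E] [DecidableEq V] (n : ℕ) : Prop :=
  ∀ ends' : E → Sym2 V, nonLoopCard ends' < n → ∀ p' : E → R, IsProbVec p' →
    ∀ o a₁ a₂ a₃ b : V, a₁ ≠ a₂ → a₁ ≠ a₃ → a₂ ≠ a₃ → o ≠ a₁ → o ≠ a₂ → o ≠ a₃ → o ≠ b →
      b ≠ a₁ → b ≠ a₂ → b ≠ a₃ → HCov p' ends' o a₁ a₂ a₃ b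

end Closure

/-! ## Relocating the loops at a leaf -/

section Relocate

variable {V : Type*} {E : Type*} [Fintype E] [DecidableEq E] [DecidableEq V]

/-- **Relocating the loops at a leaf `v`**: if `v` has non-loop degree one, there is an incidence
map `ends₁` agreeing with `ends` on every non-loop edge of either — so with the same `Gc` and at most
as many non-loop edges — in which the leaf edge `e = {x, v}` is the ONLY edge at `v`. -/
lemma exists_relocated {ends : E → Sym2 V} {v : V} (h : nonLoopDeg ends v = 1) :
    ∃ (ends₁ : E → Sym2 V) (e : E) (x : V), ends₁ e = s(x, v) ∧ x ≠ v ∧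
      (∀ g, v ∈ ends₁ g → g = e) ∧ (∀ g, ¬ (ends g).IsDiag → ends₁ g = ends g) ∧
      (∀ g, ¬ (ends₁ g).IsDiag → ends₁ g = ends g) ∧ ends e = s(x, v) ∧
      ∀ g, g ≠ e → v ∈ ends g → (ends g).IsDiag := by
  obtain ⟨e, x, he, hxv, hleaf⟩ := leaf_of_nonLoopDeg_one h
  refine ⟨fun g => if g ≠ e ∧ v ∈ ends g then s(x, x) else ends g, e, x, ?_, hxv, ?_, ?_, ?_, he,
    hleaf⟩
  · dsimp only
    rw [if_neg (fun h => h.1 rfl), he]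
  · intro g hvg
    by_contra hge
    dsimp only at hvg
    by_cases hvg' : v ∈ ends g
    · rw [if_pos ⟨hge, hvg'⟩, Sym2.mem_iff] at hvg
      rcases hvg with h | h <;> exact hxv h.symm
    · rw [if_neg (fun h => hvg' h.2)] at hvg
      exact hvg' hvg
  · intro g hg
    dsimp only
    exact if_neg (fun h => hg (hleaf g h.1 h.2))
  · intro g hg
    dsimp only at hg ⊢
    by_cases hc : g ≠ e ∧ v ∈ ends g
    · rw [if_pos hc, Sym2.mk_isDiag_iff] at hg
      exact absurd rfl hg
    · exact if_neg hc

omit [Fintype E] [DecidableEq E] [DecidableEq V] in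
/-- The leaf edge of a leaf is unique: any non-loop edge `{x', v}` at the leaf `v` is the leaf edge,
and `x' = x`. -/
lemma eq_of_leaf_edge {ends : E → Sym2 V} {v x x' : V} {e e' : E} (he : ends e = s(x, v))
    (hxv : x ≠ v) (huniq : ∀ g, g ≠ e → v ∈ ends g → (ends g).IsDiag) (he' : ends e' = s(x', v))
    (hx'v : x' ≠ v) : x' = x := by
  have hee : e' = e := by
    by_contra h
    have := huniq e' h (by rw [he']; exact Sym2.mem_mk_right x' v)
    rw [he', Sym2.mk_isDiag_iff] at this
    exact hx'v this
  subst hee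
  rw [he] at he'
  rcases Sym2.eq_iff.mp he' with ⟨h1, _⟩ | ⟨h1, _⟩
  · exact h1.symm
  · exact absurd h1 hxv

end Relocate

/-! ## The `o`-leaf and `b`-leaf steps -/

section Steps

variable {R : Type*} [Field R] [LinearOrder R] [IsStrictOrderedRing R]

/-- **The `o`-leaf step**: if `o` has non-loop degree one, (HCOV) follows from (HCOV) on the
instances with fewer non-loop edges (the loops at `o` are relocated, `o` is moved to its
neighbour `x`; at a marked `x` the landed coincidence theorems apply). -/
theorem HCov_of_o_leaf {V E : Type} [Fintype V] [DecidableEq V] [Fintype E] [DecidableEq E]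
    {n : ℕ} (ih : IHBelow R V E n) (ends : E → Sym2 V) (hn : nonLoopCard ends = n) (p : E → R)
    (hp : IsProbVec p) (o a₁ a₂ a₃ b : V) (h12 : a₁ ≠ a₂) (h13 : a₁ ≠ a₃) (h23 : a₂ ≠ a₃)
    (ho1 : o ≠ a₁) (ho2 : o ≠ a₂) (ho3 : o ≠ a₃) (hob : o ≠ b) (hb1 : b ≠ a₁) (hb2 : b ≠ a₂)
    (hb3 : b ≠ a₃) (hdo : nonLoopDeg ends o = 1) : HCov p ends o a₁ a₂ a₃ b := by
  obtain ⟨ends₁, e, x, h₁e, hxo, hleaf₁, hagree, hagree', -, -⟩ := exists_relocated hdo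
  have hGc : Gc p ends o a₁ a₂ a₃ b = Gc p ends₁ o a₁ a₂ a₃ b :=
    Gc_eq_of_agree_nonLoop p hagree hagree' o a₁ a₂ a₃ b
  have hcard : nonLoopCard ends₁ ≤ n := hn ▸ nonLoopCard_le_of_agree hagree'
  have hf₁ : ends₁ e = s(o, x) := by rw [h₁e, Sym2.eq_swap]
  unfold HCov
  rw [hGc]
  by_cases hx1 : x = a₁
  · have hf' : ends₁ e = s(o, a₁) := by rw [← hx1]; exact hf₁
    rw [RootCoincidence.Gc_o_leaf_at_root p ends₁ hf' hleaf₁ ho1 ho2 ho3 hob]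
  by_cases hx2 : x = a₂
  · have hf' : ends₁ e = s(o, a₂) := by rw [← hx2]; exact hf₁
    rw [← Gc_swap p ends₁ o a₁ a₂ a₃ b,
      RootCoincidence.Gc_o_leaf_at_root p ends₁ hf' hleaf₁ ho2 ho1 ho3 hob]
  by_cases hx3 : x = a₃
  · rw [SepZero.Gc_eq_zero_of_o_leaf_at_a3 p ends₁ o a₁ a₂ a₃ b
      (fun g hg => by rw [hleaf₁ g hg, hf₁, hx3]) ho1 ho2]
  by_cases hxb : x = b
  · have hf' : ends₁ e = s(o, b) := by rw [← hxb]; exact hf₁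
    exact PendantOB.HCov_pendant_o_at_b p hp ends₁ hf' hleaf₁ hob ho1 ho2 ho3
  -- `x` unmarked: move `o` to `x`; the old `o` is then an unmarked leaf at `x`
  refine LeafLinearity.HCov_leaf_o_of p hp ends₁ hf₁ hleaf₁ hxo.symm ho1 ho2 ho3 hob ?_
  unfold HCov
  rw [Gc_leaf_at p h₁e hxo ⟨hxo.symm, ho1, ho2, ho3, hob⟩
    (fun g hge hog => absurd (hleaf₁ g hog) hge)]
  have hne : ¬ (ends₁ e).IsDiag := by
    rw [h₁e, Sym2.mk_isDiag_iff]
    exact hxo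
  exact ih _ (lt_of_lt_of_le (nonLoopCard_update_loop_lt ends₁ hne x) hcard) p hp x a₁ a₂ a₃ b
    h12 h13 h23 hx1 hx2 hx3 hxb hb1 hb2 hb3

/-- **The `b`-leaf step**: if `b` has non-loop degree one, (HCOV) follows from (HCOV) on the
instances with fewer non-loop edges (mirror of `HCov_of_o_leaf`). -/
theorem HCov_of_b_leaf {V E : Type} [Fintype V] [DecidableEq V] [Fintype E] [DecidableEq E]
    {n : ℕ} (ih : IHBelow R V E n) (ends : E → Sym2 V) (hn : nonLoopCard ends = n) (p : E → R)
    (hp : IsProbVec p) (o a₁ a₂ a₃ b : V) (h12 : a₁ ≠ a₂) (h13 : a₁ ≠ a₃) (h23 : a₂ ≠ a₃)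
    (ho1 : o ≠ a₁) (ho2 : o ≠ a₂) (ho3 : o ≠ a₃) (hob : o ≠ b) (hb1 : b ≠ a₁) (hb2 : b ≠ a₂)
    (hb3 : b ≠ a₃) (hdb : nonLoopDeg ends b = 1) : HCov p ends o a₁ a₂ a₃ b := by
  obtain ⟨ends₁, e, x, h₁e, hxb, hleaf₁, hagree, hagree', -, -⟩ := exists_relocated hdb
  have hbo : b ≠ o := hob.symm
  have hGc : Gc p ends o a₁ a₂ a₃ b = Gc p ends₁ o a₁ a₂ a₃ b :=
    Gc_eq_of_agree_nonLoop p hagree hagree' o a₁ a₂ a₃ b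
  have hcard : nonLoopCard ends₁ ≤ n := hn ▸ nonLoopCard_le_of_agree hagree'
  have hf₁ : ends₁ e = s(b, x) := by rw [h₁e, Sym2.eq_swap]
  unfold HCov
  rw [hGc]
  by_cases hx1 : x = a₁
  · have hf' : ends₁ e = s(b, a₁) := by rw [← hx1]; exact hf₁
    rw [RootCoincidence.Gc_b_leaf_at_root p ends₁ hf' hleaf₁ hb1 hbo hb2 hb3]
  by_cases hx2 : x = a₂
  · have hf' : ends₁ e = s(b, a₂) := by rw [← hx2]; exact hf₁
    rw [← Gc_swap p ends₁ o a₁ a₂ a₃ b,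
      RootCoincidence.Gc_b_leaf_at_root p ends₁ hf' hleaf₁ hb2 hbo hb1 hb3]
  by_cases hx3 : x = a₃
  · have hf' : ends₁ e = s(b, a₃) := by rw [← hx3]; exact hf₁
    exact DiagBA3.HCov_pendant_b_at_a3 p hp ends₁ hf' hleaf₁ hb3 hbo hb1 hb2
  by_cases hxo : x = o
  · have hf' : ends₁ e = s(b, o) := by rw [← hxo]; exact hf₁
    exact PendantBO.HCov_pendant_b_at_o p hp ends₁ hf' hleaf₁ hbo hb1 hb2 hb3
  -- `x` unmarked: move `b` to `x`; the old `b` is then an unmarked leaf at `x`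
  refine LeafLinearity.HCov_leaf_b_of p hp ends₁ hf₁ hleaf₁ hxb.symm hbo hb1 hb2 hb3 ?_
  unfold HCov
  rw [Gc_leaf_at p h₁e hxb ⟨hbo, hb1, hb2, hb3, hxb.symm⟩
    (fun g hge hbg => absurd (hleaf₁ g hbg) hge)]
  have hne : ¬ (ends₁ e).IsDiag := by
    rw [h₁e, Sym2.mk_isDiag_iff]
    exact hxb
  exact ih _ (lt_of_lt_of_le (nonLoopCard_update_loop_lt ends₁ hne x) hcard) p hp o a₁ a₂ a₃ x
    h12 h13 h23 ho1 ho2 ho3 (fun h => hxo h.symm) hx1 hx2 hx3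

end Steps

/-! ## The reduction -/

section Main

variable {R : Type*} [Field R] [LinearOrder R] [IsStrictOrderedRing R]

/-- **The reduction to the weighted reduced class, by strong induction on the number of non-loop
edges**: a parallel pair is merged, an unmarked leaf deleted, an unmarked series vertex
contracted, an `o`- or `b`-leaf moved; else the instance is in `WReduced`. -/
theorem HCov_of_wred_of_base {V E : Type} [Fintype V] [DecidableEq V] [Fintype E] [DecidableEq E]
    (hB : HCovWRed_all R) (n : ℕ) :
    ∀ (ends : E → Sym2 V), nonLoopCard ends = n → ∀ (p : E → R), IsProbVec p →
      ∀ o a₁ a₂ a₃ b : V, a₁ ≠ a₂ → a₁ ≠ a₃ → a₂ ≠ a₃ → o ≠ a₁ → o ≠ a₂ → o ≠ a₃ → o ≠ b →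
        b ≠ a₁ → b ≠ a₂ → b ≠ a₃ → HCov p ends o a₁ a₂ a₃ b := by
  induction n using Nat.strong_induction_on with
  | _ n ih =>
  intro ends hn p hp o a₁ a₂ a₃ b h12 h13 h23 ho1 ho2 ho3 hob hb1 hb2 hb3
  have ih' : IHBelow R V E n := fun ends' hlt => ih _ hlt ends' rfl
  by_cases hsimp : Simple ends
  · by_cases hun : ∃ y, Unmarked o a₁ a₂ a₃ b y ∧
        (nonLoopDeg ends y = 1 ∨ nonLoopDeg ends y = 2)
    · obtain ⟨y, hy, hd⟩ := hun
      rcases hd with h1 | h2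
      · -- an unmarked leaf: delete it
        obtain ⟨e, x, he, hxy, hleaf⟩ := leaf_of_nonLoopDeg_one h1
        have hne : ¬ (ends e).IsDiag := by
          rw [he, Sym2.mk_isDiag_iff]
          exact hxy
        unfold HCov
        rw [Gc_leaf_at p he hxy hy hleaf]
        exact ih' _ (hn ▸ nonLoopCard_update_loop_lt ends hne x) p hp o a₁ a₂ a₃ b h12 h13 h23
          ho1 ho2 ho3 hob hb1 hb2 hb3
      · -- an unmarked series vertex: contract it
        obtain ⟨e, f, x, w, hef, he, hf, hxy, hyw, hdeg⟩ := series_of_nonLoopDeg_two h2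
        unfold HCov
        rw [Gc_series_at p he hf hef hxy hyw hy hdeg]
        exact ih' _ (hn ▸ nonLoopCard_contract_lt ends hxy he) _ (isProbVec_series hp e f)
          o a₁ a₂ a₃ b h12 h13 h23 ho1 ho2 ho3 hob hb1 hb2 hb3
    · by_cases hdo : nonLoopDeg ends o = 1
      · exact HCov_of_o_leaf ih' ends hn p hp o a₁ a₂ a₃ b h12 h13 h23 ho1 ho2 ho3 hob hb1 hb2
          hb3 hdo
      · by_cases hdb : nonLoopDeg ends b = 1
        · exact HCov_of_b_leaf ih' ends hn p hp o a₁ a₂ a₃ b h12 h13 h23 ho1 ho2 ho3 hob hb1 hb2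
            hb3 hdb
        · -- the weighted reduced class
          push Not at hun
          exact hB V E ends p hp o a₁ a₂ a₃ b h12 h13 h23 ho1 ho2 ho3 hob hb1 hb2 hb3
            ⟨hsimp, hun, hdo, hdb⟩
  · -- a parallel pair: merge it
    unfold Simple at hsimp
    push Not at hsimp
    obtain ⟨g₁, g₂, hg12, hnd, hpar⟩ := hsimp
    obtain ⟨u, v, huv⟩ : ∃ u v, ends g₁ = s(u, v) :=
      (Sym2.exists (f := fun t => ends g₁ = t)).1 ⟨ends g₁, rfl⟩
    have hnd2 : ¬ (ends g₂).IsDiag := by rw [← hpar]; exact hnd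
    unfold HCov
    rw [Gc_parallel p hg12 hpar.symm u o a₁ a₂ a₃ b]
    exact ih' _ (hn ▸ nonLoopCard_update_loop_lt ends hnd2 u) _ (isProbVec_parallel hp g₁ g₂)
      o a₁ a₂ a₃ b h12 h13 h23 ho1 ho2 ho3 hob hb1 hb2 hb3

/-- **THE WEIGHTED REDUCED-CLASS THEOREM**: (HCOV) for every finite weighted graph with five
distinct marks follows from (HCOV) on the weighted reduced class — simple graphs whose unmarked
vertices have non-loop degree `0` or `≥ 3` and whose `o`, `b` are not leaves. -/
theorem HCov_all_of_HCovWRed_all (hB : HCovWRed_all R) : HCov_all R := by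
  intro V E _ _ _ _ ends p hp o a₁ a₂ a₃ b h12 h13 h23 ho1 ho2 ho3 hob hb1 hb2 hb3
  exact HCov_of_wred_of_base hB _ ends rfl p hp o a₁ a₂ a₃ b h12 h13 h23 ho1 ho2 ho3 hob hb1 hb2
    hb3

/-- The reduced class is a faithful reduction: `HCov_all ↔ HCovWRed_all`. -/
theorem HCov_all_iff_HCovWRed_all : HCov_all R ↔ HCovWRed_all R :=
  ⟨fun h V E _ _ _ _ ends p hp o a₁ a₂ a₃ b h12 h13 h23 ho1 ho2 ho3 hob hb1 hb2 hb3 _ =>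
    h V E ends p hp o a₁ a₂ a₃ b h12 h13 h23 ho1 ho2 ho3 hob hb1 hb2 hb3,
   HCov_all_of_HCovWRed_all⟩

end Main

end WRed

end Summit.Ventures.PercRepro2
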